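import Literature.AlgebraicGeometry.Motives.HodgeStructureIntegralLatticeCorrespondenceClasses
import Literature.AlgebraicGeometry.Motives.HodgeStructureCorrespondenceComposition
import Literature.AlgebraicGeometry.Motives.HodgeStructureCorrespondenceTranspose
import HarnessLib

/-!
# Integral correspondences are closed under composition and transpose: `H•(X₂ × X₃, ℤ) ∘ H•(X₁ × X₂, ℤ) ⊆ H•(X₁ × X₃, ℤ)` and
# `ᵗ(H•(X₁ × X₂, ℤ)) = H•(X₂ × X₁, ℤ)` (Lange, Lemma 6.2.8; Milne 1999 §5)

[topic AlgebraicGeometry/Motives]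

Layer `Literature/AlgebraicGeometry/Motives` (namespace `Literature.AlgebraicGeometry.Motives.ExteriorLefschetz`), lane `lit-hodgefound`
(Track 2 foundations library; prover seat `lit-hodgefound-p34`, generation 39, row g39-#11 — last row of the generation's arc on integral
correspondences).  THEOREMS ONLY (no `def`, no named fact, no instance, no notation; D-0026 net debt `0`).  Built on g39-#8/#10
(`HodgeStructureIntegralLatticeKunneth`, `…CorrespondenceClasses`: the Künneth lattice `L₁ ⊠ L₂ = span_ℤ {p^*w_A ∧ q^*w_B} =
H•(X₁ × X₂, ℤ)` and the criterion `u ∈ L₁ ⊠ L₂ ⟺ ū(H•(X₁, ℤ)) ⊆ H•(X₂, ℤ)`), on g33-#1 (`HodgeStructureCorrespondenceComposition`: the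
composition `corrComp ω₂ g₂ v u = p₁₃_*(p₁₂^*u ∧ p₂₃^*v)` with `(v ∘ u)‾ = v̄ ∘ ū`, `corrMap_corrComp_apply`) and on
`HodgeStructureCorrespondenceTranspose` (the transpose `ᵗu = ⋀(prodComm) u`, `map_prodComm_map_inl/inr`).

## Sources, VERBATIM

* H. Lange, *Abelian Varieties over the Complex Numbers* (2023) [Lange2023AbelianVarietiesComplex], §6.2.2 Lemma 6.2.8: for correspondences
  `u` on `X₁ × X₂` and `v` on `X₂ × X₃`, "`(v ∘ u)‾ = v̄ ∘ ū`" with `v ∘ u := p₁₃_*(p₁₂^*u · p₂₃^*v)` (in the tree: `corrMap_corrComp_apply`);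
  §6.2.2 (p. 304) the transpose `ᵗZ` of a correspondence.
* J. S. Milne, *Lefschetz classes on abelian varieties*, Duke Math. J. **96** (1999) [Milne1999LefschetzClasses], §5 pp. 664–665: the
  dictionary `u ↦ ū` ("is an isomorphism") and Thm. 5.9 (the algebra of correspondences under composition; transposes).
  Since `p_{ij}^*`, `∪` and `p₁₃_*` are defined integrally, compositions and transposes of integral classes are integral; in the model this
  is PROVED from the criterion of g39-#10.

## Contents (all proved)

* §1 **`corrComp_mem_kunnethSpan`** (`u ∈ L₁ ⊠ L₂`, `v ∈ L₂ ⊠ L₃ ⟹ v ∘ u ∈ L₁ ⊠ L₃`), `corrEquiv_symm_comp_mem_kunnethSpan`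
  (`[S ∘ T] ∈ H•(X₁ × X₃, ℤ)` when `T(H•(X₁, ℤ)) ⊆ H•(X₂, ℤ)` and `S(H•(X₂, ℤ)) ⊆ H•(X₃, ℤ)`).
* §2 **`map_prodComm_mem_kunnethSpan`** (`u ∈ L₁ ⊠ L₂ ⟹ ᵗu ∈ L₂ ⊠ L₁`), `map_prodComm_map_prodComm` (`ᵗᵗu = u`),
  **`map_prodComm_mem_kunnethSpan_iff`**.
-/

open scoped TensorProduct

namespace Literature.AlgebraicGeometry.Motives

namespace ExteriorLefschetz

open ExteriorAlgebra Module

variable {K : Type*} [Field K] [CharZero K] {W₁ W₂ W₃ : Type*} [AddCommGroup W₁] [Module K W₁] [AddCommGroup W₂] [Module K W₂]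
  [AddCommGroup W₃] [Module K W₃] {g₁ g₂ g₃ : ℕ}
  (b₁ : Basis (Fin g₁ ⊕ Fin g₁) K W₁) (b₂ : Basis (Fin g₂ ⊕ Fin g₂) K W₂) (b₃ : Basis (Fin g₃ ⊕ Fin g₃) K W₃)

/-! ## §1 Composition -/

/-- **Integral correspondences compose integrally**: for `u ∈ H•(X₁ × X₂, ℤ) = L₁ ⊠ L₂` and `v ∈ H•(X₂ × X₃, ℤ) = L₂ ⊠ L₃`, the composition
`v ∘ u = p₁₃_*(p₁₂^*u ∧ p₂₃^*v)` lies in `H•(X₁ × X₃, ℤ) = L₁ ⊠ L₃` — `(v ∘ u)‾ = v̄ ∘ ū` maps `H•(X₁, ℤ)` into `H•(X₃, ℤ)`.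
[cite: Lange2023AbelianVarietiesComplex, §6.2.2 Lemma 6.2.8 ("(v ∘ u)‾ = v̄ ∘ ū")] [cite: Milne1999LefschetzClasses, §5 pp. 664–665] -/
theorem corrComp_mem_kunnethSpan {u : ExteriorAlgebra K (W₁ × W₂)} {v : ExteriorAlgebra K (W₂ × W₃)}
    (hu : u ∈ Submodule.span ℤ (Set.image2 (fun x y ↦ ExteriorAlgebra.map (LinearMap.inl K W₁ W₂) x * ExteriorAlgebra.map (LinearMap.inr K W₁ W₂) y)
        (Set.range (weightBasis b₁)) (Set.range (weightBasis b₂))))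
    (hv : v ∈ Submodule.span ℤ (Set.image2 (fun x y ↦ ExteriorAlgebra.map (LinearMap.inl K W₂ W₃) x * ExteriorAlgebra.map (LinearMap.inr K W₂ W₃) y)
        (Set.range (weightBasis b₂)) (Set.range (weightBasis b₃)))) :
    corrComp (twoVector b₂) g₂ v u ∈
      Submodule.span ℤ (Set.image2 (fun x y ↦ ExteriorAlgebra.map (LinearMap.inl K W₁ W₃) x * ExteriorAlgebra.map (LinearMap.inr K W₁ W₃) y)
        (Set.range (weightBasis b₁)) (Set.range (weightBasis b₃))) := by
  refine (mem_kunnethSpan_iff_forall_corrMap_mem b₁ b₃).2 fun x hx ↦ ?_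
  rw [corrMap_corrComp_apply]
  exact corrMap_mem_span_weightBasis b₂ b₃ hv (corrMap_mem_span_weightBasis b₁ b₂ hu hx)

/-- **`[S ∘ T] ∈ H•(X₁ × X₃, ℤ)`** for operators `T : H•(X₁) → H•(X₂)`, `S : H•(X₂) → H•(X₃)` preserving the integral lattices (the
class of a composite is the composite of the classes). [cite: Lange2023AbelianVarietiesComplex, §6.2.2 Lemma 6.2.8]
[cite: Milne1999LefschetzClasses, §5 pp. 664–665] -/
theorem corrEquiv_symm_comp_mem_kunnethSpan {T : ExteriorAlgebra K W₁ →ₗ[K] ExteriorAlgebra K W₂}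
    {S : ExteriorAlgebra K W₂ →ₗ[K] ExteriorAlgebra K W₃}
    (hT : ∀ x ∈ Submodule.span ℤ (Set.range (weightBasis b₁)), T x ∈ Submodule.span ℤ (Set.range (weightBasis b₂)))
    (hS : ∀ y ∈ Submodule.span ℤ (Set.range (weightBasis b₂)), S y ∈ Submodule.span ℤ (Set.range (weightBasis b₃))) :
    (isSymplectic_twoVector b₁).corrEquiv.symm (S ∘ₗ T) ∈
      Submodule.span ℤ (Set.image2 (fun x y ↦ ExteriorAlgebra.map (LinearMap.inl K W₁ W₃) x * ExteriorAlgebra.map (LinearMap.inr K W₁ W₃) y)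
        (Set.range (weightBasis b₁)) (Set.range (weightBasis b₃))) :=
  (corrEquiv_symm_mem_kunnethSpan_iff b₁ b₃ _).2 fun x hx ↦ hS _ (hT x hx)

/-! ## §2 Transpose -/

omit [CharZero K] in
/-- **The transpose of an integral correspondence is integral**: `ᵗu = ⋀(prodComm) u ∈ H•(X₂ × X₁, ℤ)` for `u ∈ H•(X₁ × X₂, ℤ)`
(`ᵗ(p^*w_A ∧ q^*w_B) = q′^*w_A ∧ p′^*w_B = ± p′^*w_B ∧ q′^*w_A`). [cite: Lange2023AbelianVarietiesComplex, §6.2.2 (p. 304, ᵗZ)]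
[cite: Milne1999LefschetzClasses, §5 Thm. 5.9 (p. 665)] -/
theorem map_prodComm_mem_kunnethSpan {u : ExteriorAlgebra K (W₁ × W₂)}
    (hu : u ∈ Submodule.span ℤ (Set.image2 (fun x y ↦ ExteriorAlgebra.map (LinearMap.inl K W₁ W₂) x * ExteriorAlgebra.map (LinearMap.inr K W₁ W₂) y)
        (Set.range (weightBasis b₁)) (Set.range (weightBasis b₂)))) :
    ExteriorAlgebra.map (LinearEquiv.prodComm K W₁ W₂ : (W₁ × W₂) →ₗ[K] (W₂ × W₁)) u ∈
      Submodule.span ℤ (Set.image2 (fun x y ↦ ExteriorAlgebra.map (LinearMap.inl K W₂ W₁) x * ExteriorAlgebra.map (LinearMap.inr K W₂ W₁) y)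
        (Set.range (weightBasis b₂)) (Set.range (weightBasis b₁))) := by
  induction hu using Submodule.span_induction with
  | mem u hu =>
    obtain ⟨x, ⟨A, rfl⟩, y, ⟨B, rfl⟩, rfl⟩ := hu
    rw [map_mul, map_prodComm_map_inl, map_prodComm_map_inr, map_inr_weightBasis_mul_map_inl_weightBasis b₂ b₁ A B,
      Units.smul_def]
    exact Submodule.smul_mem _ _ (map_inl_mul_map_inr_mem_kunnethSpan b₂ b₁ (Submodule.subset_span ⟨B, rfl⟩)
      (Submodule.subset_span ⟨A, rfl⟩))
  | zero => rw [map_zero]; exact Submodule.zero_mem _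
  | add u v _ _ hu hv => rw [map_add]; exact Submodule.add_mem _ hu hv
  | smul n u _ hu => rw [map_zsmul]; exact Submodule.smul_mem _ n hu

omit [CharZero K] in
/-- `ᵗᵗu = u` (`prodComm ∘ prodComm = id`). [cite: Lange2023AbelianVarietiesComplex, §6.2.2 (p. 304)] -/
theorem map_prodComm_map_prodComm (u : ExteriorAlgebra K (W₁ × W₂)) :
    ExteriorAlgebra.map (LinearEquiv.prodComm K W₂ W₁ : (W₂ × W₁) →ₗ[K] (W₁ × W₂))
        (ExteriorAlgebra.map (LinearEquiv.prodComm K W₁ W₂ : (W₁ × W₂) →ₗ[K] (W₂ × W₁)) u) = u := by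
  rw [← AlgHom.comp_apply, ExteriorAlgebra.map_comp_map]
  have h1 : (LinearEquiv.prodComm K W₂ W₁ : (W₂ × W₁) →ₗ[K] (W₁ × W₂)) ∘ₗ
      (LinearEquiv.prodComm K W₁ W₂ : (W₁ × W₂) →ₗ[K] (W₂ × W₁)) = LinearMap.id := LinearMap.ext fun _ ↦ rfl
  rw [h1, ExteriorAlgebra.map_id, AlgHom.id_apply]

omit [CharZero K] in
/-- **`ᵗu ∈ H•(X₂ × X₁, ℤ) ⟺ u ∈ H•(X₁ × X₂, ℤ)`.** [cite: Lange2023AbelianVarietiesComplex, §6.2.2 (p. 304, ᵗZ)]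
[cite: Milne1999LefschetzClasses, §5 Thm. 5.9 (p. 665)] -/
theorem map_prodComm_mem_kunnethSpan_iff {u : ExteriorAlgebra K (W₁ × W₂)} :
    ExteriorAlgebra.map (LinearEquiv.prodComm K W₁ W₂ : (W₁ × W₂) →ₗ[K] (W₂ × W₁)) u ∈
        Submodule.span ℤ (Set.image2 (fun x y ↦ ExteriorAlgebra.map (LinearMap.inl K W₂ W₁) x * ExteriorAlgebra.map (LinearMap.inr K W₂ W₁) y)
          (Set.range (weightBasis b₂)) (Set.range (weightBasis b₁))) ↔
      u ∈ Submodule.span ℤ (Set.image2 (fun x y ↦ ExteriorAlgebra.map (LinearMap.inl K W₁ W₂) x * ExteriorAlgebra.map (LinearMap.inr K W₁ W₂) y)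
        (Set.range (weightBasis b₁)) (Set.range (weightBasis b₂))) := by
  refine ⟨fun h ↦ ?_, map_prodComm_mem_kunnethSpan b₁ b₂⟩
  rw [← map_prodComm_map_prodComm u]
  exact map_prodComm_mem_kunnethSpan b₂ b₁ h

end ExteriorLefschetz

end Literature.AlgebraicGeometry.Motives
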